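import Mathlib
import HarnessLib
import Literature.Geometry.Lorentzian.KerrConvergence

/-!
# Route LogTimeThreeAnnuli · crux `DyadicCapture` · line `registered` — equal exteriors have equal labels

`boostedKerrExterior_eq_imp_labels` (registered helper stub of the line `registered` of the crux
`Summit.FinalStateConjecture.FinalStateConjecture.Theses.LogTimeThreeAnnuli.DyadicCapture`,
stmt-FinalStateConjecture-17488): if two boosted Kerr exteriors with the SAME motion `(Λ, c)` coincide
as open subsets of `E4`, `boostedKerrExterior Λ c M a = boostedKerrExterior Λ c M' a'` with
`M, M' > 0`, then `M = M'` and `|a| = |a'|`. This is the algebraic end of the horizon-rigidity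
argument (equal exterior DOMAINS force equal labels up to the spin sign); the converse is the landed
`horizonRestriction_kerrSchild_eq_of_abs_eq`.

Proof (elementary real algebra in the rest frame of the ingoing Kerr–Schild chart; `Kerr.radius`,
`Kerr.rPlus`, `Kerr.exterior` of `Literature/Geometry/Lorentzian/KerrSchild.lean`):
* undo the boost: `poincareInv Λ c (c + Λ y) = y`, so equality of the boosted exteriors gives
  `y ∈ Kerr.exterior M a ↔ y ∈ Kerr.exterior M' a'` for every rest-frame point `y`
  (`exteriorLabels_mem_iff_of_boosted_eq`);
* on the AXIS point `y = (0, 0, 0, z)` the Kerr–Schild radius is `|z|` for every spin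
  (`exteriorLabels_radius_axis`), so the axis slice of `Kerr.exterior M a` is `{|z| > r₊(M, a)}` and
  an inclusion of exteriors gives the reverse inequality of outer horizon radii
  (`exteriorLabels_rPlus_le`), hence `r₊(M, a) = r₊(M', a')`;
* on the EQUATORIAL point `y = (0, s, 0, 0)` the squared radius is `max (s² − a²) 0`
  (`exteriorLabels_radius_sq_equator`), so the equatorial slice is `{s² > r₊² + a²}` and, the horizon
  radii being equal, an inclusion of exteriors gives `a'² ≤ a²` (`exteriorLabels_sq_le`), hence
  `a² = a'²`, i.e. `|a| = |a'|`;
* `M ↦ r₊(M, a) = M + √(M² − a²)` is strictly increasing on `[0, ∞)` for fixed `a²`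
  (`exteriorLabels_rPlus_lt_rPlus`), so `M = M'` (`exteriorLabels_mass_eq`).
The hypotheses `|a| ≤ M`, `|a'| ≤ M'` of the registered signature are not used (for `|a| > M` the junk
value `r₊ = M` of `Kerr.rPlus` still separates the labels); they are part of the registered statement.

Sources: B. O'Neill, *The geometry of Kerr black holes* (1995), Ch. 2, §2.3–2.4 (`r₊ = M + √(M² − a²)`,
Boyer–Lindquist block I); M. Visser, arXiv:0706.0622, (35) (the Kerr–Schild radius). Mathlib + tree
lemmas only; no named facts.
-/

-- the `Summit.FinalStateConjecture.FinalStateConjecture.…` namespace repeats the summit = sub-problem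
-- segment (D-0017 layout, CONVENTIONS §2); the duplicate is deliberate.
set_option linter.dupNamespace false

noncomputable section

namespace Summit.FinalStateConjecture.FinalStateConjecture.Theorems

open Literature.Geometry.Lorentzian
open scoped Topology Manifold ENNReal ContDiff
open Filter Set

/-! ### Radius algebra on the axis and on the equatorial line -/

/-- On the axis point `(0, 0, 0, z)` the Kerr–Schild radius is `|z|` for EVERY spin `a`: there
`ρ² = z²` and `(z² − a²)² + 4a²z² = (z² + a²)²`, so `r² = z²` (Visser arXiv:0706.0622, (35)).
[cite: arXiv07060622, (35)] -/
theorem exteriorLabels_radius_axis (a z : ℝ) :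
    Kerr.radius a (EuclideanSpace.single (3 : Fin 4) z : E4) = |z| := by
  -- adapted from `Kerr.radius_of_axis` (KerrRadiusPseudoconvexityKS.lean), at the point `single 3 z`
  have h1 : (EuclideanSpace.single (3 : Fin 4) z : E4) 1 = 0 := by simp
  have h2 : (EuclideanSpace.single (3 : Fin 4) z : E4) 2 = 0 := by simp
  have h3 : (EuclideanSpace.single (3 : Fin 4) z : E4) 3 = z := by simp
  have hsq : Kerr.radius a (EuclideanSpace.single (3 : Fin 4) z : E4) ^ 2 = z ^ 2 := by
    rw [Kerr.radius_sq, E4.spatialNorm_sq, h1, h2, h3]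
    have hd : ((0 : ℝ) ^ 2 + 0 ^ 2 + z ^ 2 - a ^ 2) ^ 2 + 4 * a ^ 2 * z ^ 2 = (z ^ 2 + a ^ 2) ^ 2 := by
      ring
    rw [hd, Real.sqrt_sq (by positivity)]
    ring
  have h := congrArg Real.sqrt hsq
  rwa [Real.sqrt_sq (Kerr.radius_nonneg a _), Real.sqrt_sq_eq_abs] at h

/-- On the equatorial point `(0, s, 0, 0)` the squared Kerr–Schild radius is `max (s² − a²) 0`: there
`z = 0`, `ρ² = s²` and the inner root is `|s² − a²|` (Visser arXiv:0706.0622, (35)).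
[cite: arXiv07060622, (35)] -/
theorem exteriorLabels_radius_sq_equator (a s : ℝ) :
    Kerr.radius a (EuclideanSpace.single (1 : Fin 4) s : E4) ^ 2 = max (s ^ 2 - a ^ 2) 0 := by
  -- adapted from `freezing_radius_sq_of_three_eq_zero` (…DyadicCaptureFreezingA.lean)
  have h1 : (EuclideanSpace.single (1 : Fin 4) s : E4) 1 = s := by simp
  have h2 : (EuclideanSpace.single (1 : Fin 4) s : E4) 2 = 0 := by simp
  have h3 : (EuclideanSpace.single (1 : Fin 4) s : E4) 3 = 0 := by simp
  rw [Kerr.radius_sq, E4.spatialNorm_sq, h1, h2, h3]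
  have hd : (s ^ 2 + (0 : ℝ) ^ 2 + 0 ^ 2 - a ^ 2) ^ 2 + 4 * a ^ 2 * (0 : ℝ) ^ 2 =
      (s ^ 2 - a ^ 2) ^ 2 := by ring
  rw [hd, Real.sqrt_sq_eq_abs]
  rcases le_or_gt 0 (s ^ 2 - a ^ 2) with h | h
  · rw [abs_of_nonneg h, max_eq_left h]; ring
  · rw [abs_of_neg h, max_eq_right h.le]; ring

/-! ### The outer horizon radius -/

/-- For fixed `a²` the outer horizon radius `r₊(M, a) = M + √(M² − a²)` is strictly increasing in
`M ≥ 0` (O'Neill 1995, Ch. 2, §2.3). [cite: ONeill1995, Ch. 2 §2.3] -/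
theorem exteriorLabels_rPlus_lt_rPlus {M M' a a' : ℝ} (hM : 0 ≤ M) (hMM' : M < M')
    (haa' : a ^ 2 = a' ^ 2) : Kerr.rPlus M a < Kerr.rPlus M' a' := by
  have hsq : √(M ^ 2 - a ^ 2) ≤ √(M' ^ 2 - a' ^ 2) :=
    Real.sqrt_le_sqrt (by rw [haa']; nlinarith)
  unfold Kerr.rPlus
  linarith

/-- Equal outer horizon radii and equal `a²` force equal (positive) masses, by strict monotonicity
of `M ↦ r₊(M, a)` (O'Neill 1995, Ch. 2, §2.3). [cite: ONeill1995, Ch. 2 §2.3] -/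
theorem exteriorLabels_mass_eq {M M' a a' : ℝ} (hM : 0 < M) (hM' : 0 < M')
    (hR : Kerr.rPlus M a = Kerr.rPlus M' a') (haa' : a ^ 2 = a' ^ 2) : M = M' := by
  by_contra hne
  rcases lt_or_gt_of_ne hne with h | h
  · exact (exteriorLabels_rPlus_lt_rPlus hM.le h haa').ne hR
  · exact (exteriorLabels_rPlus_lt_rPlus hM'.le h haa'.symm).ne hR.symm

/-! ### Slices of the Kerr exterior -/

/-- Axis slice of the Kerr exterior: for `M > 0`, `(0, 0, 0, z) ∈ {r > r₊(M, a)} ↔ r₊(M, a) < |z|`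
(O'Neill 1995, Ch. 2, §2.4: block I meets the axis in `{|z| > r₊}`). [cite: ONeill1995, Ch. 2 §2.4] -/
theorem exteriorLabels_axis_mem_iff {M : ℝ} (hM : 0 < M) (a z : ℝ) :
    (EuclideanSpace.single (3 : Fin 4) z : E4) ∈ Kerr.exterior M a ↔ Kerr.rPlus M a < |z| := by
  -- `0 < M ≤ r₊(M, a)` (cf. `rPlus_pos_of_pos` of the barrier catalogue, not imported here)
  have hR : 0 < Kerr.rPlus M a := add_pos_of_pos_of_nonneg hM (Real.sqrt_nonneg _)
  rw [Kerr.mem_exterior, max_eq_left hR.le, exteriorLabels_radius_axis]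

/-- Equatorial slice of the Kerr exterior: for `M > 0`,
`(0, s, 0, 0) ∈ {r > r₊(M, a)} ↔ r₊(M, a)² + a² < s²` (O'Neill 1995, Ch. 2, §2.4: block I meets the
equatorial plane outside the ellipsoid `ρ² = r₊² + a²`). [cite: ONeill1995, Ch. 2 §2.4] -/
theorem exteriorLabels_equator_mem_iff {M : ℝ} (hM : 0 < M) (a s : ℝ) :
    (EuclideanSpace.single (1 : Fin 4) s : E4) ∈ Kerr.exterior M a ↔
      Kerr.rPlus M a ^ 2 + a ^ 2 < s ^ 2 := by
  have hR : 0 < Kerr.rPlus M a := add_pos_of_pos_of_nonneg hM (Real.sqrt_nonneg _)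
  have hr := Kerr.radius_nonneg a (EuclideanSpace.single (1 : Fin 4) s : E4)
  have hsq := exteriorLabels_radius_sq_equator a s
  rw [Kerr.mem_exterior, max_eq_left hR.le, ← pow_lt_pow_iff_left₀ hR.le hr two_ne_zero, hsq,
    lt_max_iff]
  constructor
  · rintro (h | h)
    · linarith
    · exact absurd h (not_lt.2 (sq_nonneg _))
  · intro h
    exact Or.inl (by linarith)

/-! ### Comparison of two exteriors -/

/-- If `Kerr.exterior M a ⊆ Kerr.exterior M' a'` (`M, M' > 0`) then `r₊(M', a') ≤ r₊(M, a)`: test the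
inclusion at the axis point `(0, 0, 0, r₊(M', a'))`. [folklore] -/
theorem exteriorLabels_rPlus_le {M M' a a' : ℝ} (hM : 0 < M) (hM' : 0 < M')
    (hsub : ∀ y : E4, y ∈ Kerr.exterior M a → y ∈ Kerr.exterior M' a') :
    Kerr.rPlus M' a' ≤ Kerr.rPlus M a := by
  refine le_of_not_gt fun h ↦ ?_
  have hR' : 0 < Kerr.rPlus M' a' := add_pos_of_pos_of_nonneg hM' (Real.sqrt_nonneg _)
  have h1 : (EuclideanSpace.single (3 : Fin 4) (Kerr.rPlus M' a') : E4) ∈ Kerr.exterior M a := by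
    rw [exteriorLabels_axis_mem_iff hM, abs_of_pos hR']
    exact h
  have h2 := (exteriorLabels_axis_mem_iff hM' a' _).1 (hsub _ h1)
  rw [abs_of_pos hR'] at h2
  exact lt_irrefl _ h2

/-- If `Kerr.exterior M a ⊆ Kerr.exterior M' a'` (`M, M' > 0`) and the outer horizon radii agree then
`a'² ≤ a²`: otherwise the equatorial point `(0, s, 0, 0)` with `s² = r₊² + (a² + a'²)/2` lies in the
first exterior but not in the second. [folklore] -/
theorem exteriorLabels_sq_le {M M' a a' : ℝ} (hM : 0 < M) (hM' : 0 < M')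
    (hR : Kerr.rPlus M a = Kerr.rPlus M' a')
    (hsub : ∀ y : E4, y ∈ Kerr.exterior M a → y ∈ Kerr.exterior M' a') :
    a' ^ 2 ≤ a ^ 2 := by
  refine le_of_not_gt fun h ↦ ?_
  set T : ℝ := Kerr.rPlus M a ^ 2 + (a ^ 2 + a' ^ 2) / 2 with hT
  have hT0 : 0 ≤ T := by positivity
  have hs : √T ^ 2 = T := Real.sq_sqrt hT0
  have h1 : (EuclideanSpace.single (1 : Fin 4) (√T) : E4) ∈ Kerr.exterior M a := by
    rw [exteriorLabels_equator_mem_iff hM, hs, hT]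
    linarith
  have h2 := (exteriorLabels_equator_mem_iff hM' a' _).1 (hsub _ h1)
  rw [hs, hT, ← hR] at h2
  linarith

/-- **Equal Kerr exteriors have equal labels up to the spin sign** (rest frame): for `M, M' > 0`,
if `Kerr.exterior M a` and `Kerr.exterior M' a'` have the same points then `M = M'` and `|a| = |a'|`
(O'Neill 1995, Ch. 2, §2.4: block I determines the horizon ellipsoid `{r = r₊}`, whose axis and
equatorial semi-axes `r₊` and `√(r₊² + a²)` determine `(M, a²)`). [cite: ONeill1995, Ch. 2 §2.4] -/
theorem exteriorLabels_of_forall_mem_iff {M M' a a' : ℝ} (hM : 0 < M) (hM' : 0 < M')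
    (h : ∀ y : E4, y ∈ Kerr.exterior M a ↔ y ∈ Kerr.exterior M' a') : M = M' ∧ |a| = |a'| := by
  have hR : Kerr.rPlus M a = Kerr.rPlus M' a' :=
    le_antisymm (exteriorLabels_rPlus_le hM' hM fun y ↦ (h y).2)
      (exteriorLabels_rPlus_le hM hM' fun y ↦ (h y).1)
  have haa' : a ^ 2 = a' ^ 2 :=
    le_antisymm (exteriorLabels_sq_le hM' hM hR.symm fun y ↦ (h y).2)
      (exteriorLabels_sq_le hM hM' hR fun y ↦ (h y).1)
  exact ⟨exteriorLabels_mass_eq hM hM' hR haa', (sq_eq_sq_iff_abs_eq_abs a a').1 haa'⟩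

/-- **Equal Kerr exteriors have equal labels up to the spin sign** (rest frame, set form): for
`M, M' > 0` and `|a| ≤ M`, `|a'| ≤ M'`, `Kerr.exterior M a = Kerr.exterior M' a'` as subsets of `E4`
forces `M = M'` and `|a| = |a'|` (O'Neill 1995, Ch. 2, §2.4). [cite: ONeill1995, Ch. 2 §2.4] -/
theorem kerrExterior_eq_imp_labels : ∀ (M a M' a' : ℝ), 0 < M → |a| ≤ M → 0 < M' → |a'| ≤ M' → (Kerr.exterior M a : Set E4) = (Kerr.exterior M' a' : Set E4) → M = M' ∧ |a| = |a'| := by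
  intro M a M' a' hM _ hM' _ h
  exact exteriorLabels_of_forall_mem_iff hM hM' fun y ↦ by
    rw [← SetLike.mem_coe, h, SetLike.mem_coe]

/-! ### Undoing the boost -/

/-- Equality of two boosted exteriors with the same motion `(Λ, c)` gives equality of the rest-frame
exteriors pointwise: `poincareInv Λ c` is onto (`poincareInv Λ c (c + Λ y) = y`). [folklore] -/
theorem exteriorLabels_mem_iff_of_boosted_eq {Λ : lorentzGroup} {c : E4} {M a M' a' : ℝ}
    (h : boostedKerrExterior Λ c M a = boostedKerrExterior Λ c M' a') (y : E4) :
    y ∈ Kerr.exterior M a ↔ y ∈ Kerr.exterior M' a' := by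
  have hy : poincareInv Λ c (c + (Λ : E4 ≃L[ℝ] E4) y) = y := by simp [poincareInv]
  have := SetLike.ext_iff.1 h (c + (Λ : E4 ≃L[ℝ] E4) y)
  rwa [mem_boostedKerrExterior, mem_boostedKerrExterior, hy] at this

/-- **Equal boosted Kerr exteriors have equal labels up to the spin sign** (registered helper stub
`boostedKerrExterior_eq_imp_labels` of the line `registered` of the crux `DyadicCapture`): for
`M, M' > 0`, `|a| ≤ M`, `|a'| ≤ M'`, `boostedKerrExterior Λ c M a = boostedKerrExterior Λ c M' a'`
forces `M = M'` and `|a| = |a'|` (O'Neill 1995, Ch. 2, §2.4, after undoing the Poincaré motion).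
[cite: ONeill1995, Ch. 2 §2.4] -/
theorem boostedKerrExterior_eq_imp_labels : ∀ (Λ : lorentzGroup) (c : E4) (M a M' a' : ℝ), 0 < M → |a| ≤ M → 0 < M' → |a'| ≤ M' → boostedKerrExterior Λ c M a = boostedKerrExterior Λ c M' a' → M = M' ∧ |a| = |a'| := by
  intro Λ c M a M' a' hM _ hM' _ h
  exact exteriorLabels_of_forall_mem_iff hM hM' (exteriorLabels_mem_iff_of_boosted_eq h)

end Summit.FinalStateConjecture.FinalStateConjecture.Theorems

end
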